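import Literature.Analysis.SpecialFunctions.SpheroidalHarmonicEigenfunction
import Mathlib.Algebra.Polynomial.Derivative
import HarnessLib

/-!
# Zeros of the spheroidal shooting function at zero spheroidicity: the associated Legendre
# (Gegenbauer) case

Topic `Literature/Analysis/SpecialFunctions` (namespace `Literature.Analysis.SpecialFunctions`),
continuing `SpheroidalHarmonicSeries.lean` / `SpheroidalHarmonicEigenfunction.lean`. At
spheroidicity `κ = 0` the `m`-spheroidal equation `(1 − x²) q'' − 2(m+1) x q' + ν q = 0` is the
Gegenbauer (differentiated Legendre) equation, and for `ν = νₙ := n(n + 2m + 1)`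
(`= l(l+1) − m(m+1)` with `l = n + m`) its solution regular at the pole `x = 1` is a polynomial of
degree `n` — the recursion `2(k+1)(k+m+1) c_{k+1} = (k(k+2m+1) − νₙ) cₖ` terminates at `k = n`
(Hartman, Ch. IV §12, Exercise 12.3 (c): the associated Legendre equation; SR, CMP 329 (2014),
§2: "a Sturm–Liouville problem [...] eigenvalues `λ_{ml}`"). This file proves, by polynomial
algebra only:

* `sphmCoeff_step_kappa_zero` — the two-term recursion at `κ = 0`; `sphmCoeff_eq_zero_of_lt` /
  `sphmCoeff_ne_zero_of_le` — termination exactly at `n` for `ν = νₙ`;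
* `legPoly m n = Σ_{k ≤ n} cₖ Xᵏ` and `sphmFun m νₙ 0 t = (legPoly m n).eval t` for all `t`;
* the equation as a polynomial identity and its invariance under the reflection `X ↦ 2 − X`
  (`legOp_comp_reflect`), whence — every polynomial solution being a multiple of `legPoly` by the
  recursion — **the parity** `legPoly(2 − X) = (−1)ⁿ legPoly(X)` (`legPoly_comp_reflect`);
* consequently **the shooting function vanishes at the Legendre eigenvalues of even excess**:
  `sphmDer m νₙ 0 1 = 0` for even `n` (`sphmDer_one_eq_zero_of_even`) — i.e.
  `(ν, κ) = ((l − m)(l + m + 1), 0)` with `l − m` even is a zero of `(ν, κ) ↦ q'(1; m, ν, κ)`, the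
  starting point of the eigenvalue curves `λ_{ml}(κ)`, `λ_{ml}(0) = l(l+1)` (SR App. B); and for
  odd `n`, `q(1) = 0` (`sphmFun_one_eq_zero_of_odd`).

## References

* Y. Shlapentokh-Rothman, Comm. Math. Phys. 329 (2014) 859–891, §2 and App. B.
  Key `ShlapentokhRothman2014KleinGordon`.
* P. Hartman, *Ordinary Differential Equations*, SIAM Classics 38 (2002), Ch. IV §12,
  Exercise 12.3 (b)–(c) (Legendre and associated Legendre equations). Key `Hartman2002`.
-/

noncomputable section

open Set Filter Metric Topology Polynomial
open scoped ContDiff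

namespace Literature.Analysis.SpecialFunctions

open Literature.Analysis.ODE

/-! ### The recursion at zero spheroidicity -/

/-- The Legendre eigenvalue parameter `νₙ = n(n + 2m + 1) = l(l+1) − m(m+1)`, `l = n + m`.
[cite: ShlapentokhRothman2014KleinGordon, §2] -/
def legNu (m n : ℕ) : ℂ := (n : ℂ) * ((n : ℂ) + 2 * m + 1)

/-- `νₙ + m(m+1) = l(l+1)` with `l = n + m`. [folklore] -/
theorem legNu_add (m n : ℕ) :
    legNu m n + (m : ℂ) * ((m : ℂ) + 1) = (((n + m : ℕ) : ℂ)) * (((n + m : ℕ) : ℂ) + 1) := by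
  unfold legNu; push_cast; ring

/-- `νₙ` is real. [folklore] -/
theorem legNu_im (m n : ℕ) : (legNu m n).im = 0 := by
  unfold legNu
  rw [show (n : ℂ) * ((n : ℂ) + 2 * m + 1) = (((n : ℝ) * ((n : ℝ) + 2 * m + 1) : ℝ) : ℂ) by push_cast; ring,
    Complex.ofReal_im]

/-- **The two-term recursion at `κ = 0`**: `2(k+1)(k+m+1) c_{k+1} = (k(k+2m+1) − ν) cₖ` for all
`k`. [cite: ShlapentokhRothman2014KleinGordon, §2 (2.1)] -/
theorem sphmCoeff_step_kappa_zero (m : ℕ) (ν : ℂ) (k : ℕ) :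
    2 * ((k : ℂ) + 1) * ((k : ℂ) + m + 1) * sphmCoeff m ν 0 (k + 1) =
      ((k : ℂ) * ((k : ℂ) + 2 * m + 1) - ν) * sphmCoeff m ν 0 k := by
  match k with
  | 0 =>
    have h := sphmCoeff_rec_zero m ν 0
    push_cast at h ⊢
    linear_combination h
  | 1 =>
    have h := sphmCoeff_rec_one m ν 0
    push_cast at h ⊢
    linear_combination h
  | k + 2 =>
    have h := sphmCoeff_rec_add_two m ν 0 k
    push_cast at h ⊢
    linear_combination h

/-- The recursion factor `2(k+1)(k+m+1) ≠ 0`. [folklore] -/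
theorem two_mul_succ_mul_ne_zero (m k : ℕ) : (2 * ((k : ℂ) + 1) * ((k : ℂ) + m + 1) : ℂ) ≠ 0 := by
  have : (0 : ℝ) < 2 * ((k : ℝ) + 1) * ((k : ℝ) + m + 1) := by positivity
  exact_mod_cast this.ne'

/-- **Termination**: for `ν = νₙ` the coefficients vanish beyond `n`. [cite: Hartman2002, Ch. IV §12 Exercise 12.3] -/
theorem sphmCoeff_eq_zero_of_lt (m n : ℕ) {k : ℕ} (h : n < k) : sphmCoeff m (legNu m n) 0 k = 0 := by
  -- write `k = n + 1 + j` and induct on `j`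
  obtain ⟨j, rfl⟩ : ∃ j, k = n + 1 + j := ⟨k - (n + 1), by omega⟩
  induction j with
  | zero =>
    have hstep := sphmCoeff_step_kappa_zero m (legNu m n) n
    have hfac : ((n : ℂ) * ((n : ℂ) + 2 * m + 1) - legNu m n) = 0 := by unfold legNu; ring
    rw [hfac, zero_mul] at hstep
    rw [Nat.add_zero]
    exact (mul_eq_zero.1 hstep).resolve_left (two_mul_succ_mul_ne_zero m n)
  | succ j ih =>
    have hstep := sphmCoeff_step_kappa_zero m (legNu m n) (n + 1 + j)
    rw [ih (by omega), mul_zero] at hstep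
    rw [show n + 1 + (j + 1) = n + 1 + j + 1 by ring]
    exact (mul_eq_zero.1 hstep).resolve_left (two_mul_succ_mul_ne_zero m (n + 1 + j))

/-- **Non-vanishing up to `n`**: for `ν = νₙ` and `k ≤ n`, `cₖ ≠ 0` (the factors
`k(k+2m+1) − νₙ`, `k < n`, are non-zero). [folklore] -/
theorem sphmCoeff_ne_zero_of_le (m n : ℕ) {k : ℕ} (h : k ≤ n) : sphmCoeff m (legNu m n) 0 k ≠ 0 := by
  induction k with
  | zero => simp
  | succ k ih =>
    have hk := ih (Nat.le_of_succ_le h)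
    have hlt : k < n := h
    have hstep := sphmCoeff_step_kappa_zero m (legNu m n) k
    have hfac : ((k : ℂ) * ((k : ℂ) + 2 * m + 1) - legNu m n) ≠ 0 := by
      unfold legNu
      have hr : (k : ℝ) * ((k : ℝ) + 2 * m + 1) - (n : ℝ) * ((n : ℝ) + 2 * m + 1) < 0 := by
        have hkn : (k : ℝ) + 1 ≤ n := by exact_mod_cast hlt
        nlinarith [k.cast_nonneg (α := ℝ), m.cast_nonneg (α := ℝ)]
      have hr' : ((k : ℝ) * ((k : ℝ) + 2 * m + 1) - (n : ℝ) * ((n : ℝ) + 2 * m + 1)) ≠ 0 := hr.ne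
      exact_mod_cast hr'
    intro h0
    rw [h0, mul_zero] at hstep
    exact mul_ne_zero hfac hk hstep.symm

/-! ### The Gegenbauer polynomial and the equation as a polynomial identity -/

/-- **The polynomial solution** `legPoly m n = Σ_{k ≤ n} cₖ(m; νₙ, 0) Xᵏ` (a normalised
Gegenbauer / differentiated Legendre polynomial in `t = 1 − x`). [cite: Hartman2002, Ch. IV §12 Exercise 12.3] -/
def legPoly (m n : ℕ) : ℂ[X] := ∑ k ∈ Finset.range (n + 1), C (sphmCoeff m (legNu m n) 0 k) * X ^ k

/-- The coefficients of `legPoly` are the Frobenius coefficients (for all indices). [folklore] -/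
theorem coeff_legPoly (m n k : ℕ) : (legPoly m n).coeff k = sphmCoeff m (legNu m n) 0 k := by
  rw [legPoly, finsetSum_coeff]
  simp only [coeff_C_mul_X_pow]
  rw [Finset.sum_ite_eq (Finset.range (n + 1)) k]
  split_ifs with h
  · rfl
  · rw [Finset.mem_range, not_lt] at h
    exact (sphmCoeff_eq_zero_of_lt m n (by omega)).symm

/-- **The series is the polynomial**: `q(t; m, νₙ, 0) = legPoly(t)` for all `t`. [folklore] -/
theorem sphmFun_legNu_eq_eval (m n : ℕ) (t : ℂ) : sphmFun m (legNu m n) 0 t = (legPoly m n).eval t := by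
  rw [sphmFun, tsum_eq_sum (s := Finset.range (n + 1))]
  · rw [legPoly, eval_finsetSum]
    simp only [eval_mul, eval_C, eval_pow, eval_X]
  · intro k hk
    rw [Finset.mem_range, not_lt] at hk
    rw [sphmCoeff_eq_zero_of_lt m n (by omega), zero_mul]

/-- The shooting value is the polynomial derivative: `q'(t; m, νₙ, 0) = legPoly'(t)` for
`‖t‖ < 5/4`. [folklore] -/
theorem sphmDer_legNu_eq_eval {m n : ℕ} {t : ℂ} (ht : ‖t‖ < 5 / 4) :
    sphmDer m (legNu m n) 0 t = (derivative (legPoly m n)).eval t := by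
  have h1 : HasDerivAt (sphmFun m (legNu m n) 0) (sphmDer m (legNu m n) 0 t) t := hasDerivAt_sphmFun ht
  have h2 : HasDerivAt (fun x ↦ (legPoly m n).eval x) ((derivative (legPoly m n)).eval t) t :=
    Polynomial.hasDerivAt _ _
  have hfun : sphmFun m (legNu m n) 0 = fun x ↦ (legPoly m n).eval x := funext (sphmFun_legNu_eq_eval m n)
  rw [hfun] at h1
  exact h1.unique h2

/-- The spheroidal operator at `κ = 0` on polynomials (in the pole variable `t`):
`L Q = 2 (Q'' X) − Q'' X² + 2(m+1) Q' − 2(m+1) (Q' X) + ν Q` (`= X(2 − X)Q'' + 2(m+1)(1 − X)Q' + νQ`).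
[cite: ShlapentokhRothman2014KleinGordon, §2 (2.1)] -/
def legOp (m : ℕ) (ν : ℂ) (Q : ℂ[X]) : ℂ[X] :=
  C 2 * (derivative (derivative Q) * X) - derivative (derivative Q) * X ^ 2 +
    C (2 * ((m : ℂ) + 1)) * derivative Q - C (2 * ((m : ℂ) + 1)) * (derivative Q * X) + C ν * Q

/-- **Coefficients of the operator**: `(L Q)ₖ = 2(k+1)(k+m+1) Q_{k+1} − (k(k+2m+1) − ν) Qₖ`.
[folklore] -/
theorem coeff_legOp (m : ℕ) (ν : ℂ) (Q : ℂ[X]) (k : ℕ) :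
    (legOp m ν Q).coeff k =
      2 * ((k : ℂ) + 1) * ((k : ℂ) + m + 1) * Q.coeff (k + 1) - ((k : ℂ) * ((k : ℂ) + 2 * m + 1) - ν) * Q.coeff k := by
  simp only [legOp, coeff_add, coeff_sub, coeff_C_mul, coeff_mul_X_pow', coeff_derivative]
  have eX : ∀ P : ℂ[X], (P * X).coeff k = if 1 ≤ k then P.coeff (k - 1) else 0 := fun P ↦ by
    rw [← pow_one X, coeff_mul_X_pow']
  rw [eX, eX]
  simp only [coeff_derivative]
  match k with
  | 0 => simp
  | 1 =>
    simp
    ring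
  | k + 2 =>
    simp only [show 1 ≤ k + 2 from by omega, if_true, show 2 ≤ k + 2 from by omega, Nat.add_sub_cancel,
      show k + 2 - 1 = k + 1 from rfl]
    push_cast
    ring

/-- **`legPoly` solves the equation** (as a polynomial identity): every coefficient of
`L legPoly` is the recursion. [cite: Hartman2002, Ch. IV §12 (12.12)] -/
theorem legOp_legPoly (m n : ℕ) : legOp m (legNu m n) (legPoly m n) = 0 := by
  ext k
  rw [coeff_legOp, coeff_legPoly, coeff_legPoly, coeff_zero]
  linear_combination sphmCoeff_step_kappa_zero m (legNu m n) k

/-- **Reflection invariance of the operator**: `L (Q ∘ (2 − X)) = (L Q) ∘ (2 − X)` (the equation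
`(1 − x²)q'' − 2(m+1)xq' + νq = 0` is even in `x = 1 − t`). [folklore] -/
theorem legOp_comp_reflect (m : ℕ) (ν : ℂ) (Q : ℂ[X]) :
    legOp m ν (Q.comp (2 - X)) = (legOp m ν Q).comp (2 - X) := by
  have hg : derivative ((2 : ℂ[X]) - X) = -1 := by
    rw [derivative_sub, derivative_X, show (2 : ℂ[X]) = C 2 from (map_ofNat C 2).symm, derivative_C, zero_sub]
  have hd1 : derivative (Q.comp (2 - X)) = -(derivative Q).comp (2 - X) := by
    rw [derivative_comp, hg]; ring
  have hd2 : derivative (derivative (Q.comp (2 - X))) = (derivative (derivative Q)).comp (2 - X) := by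
    rw [hd1, derivative_neg, derivative_comp, hg]; ring
  rw [legOp, legOp, hd2, hd1]
  simp only [add_comp, sub_comp, mul_comp, C_comp, X_comp, pow_comp]
  rw [map_ofNat C 2]
  ring

/-- Coefficients of a polynomial killed by `L` satisfy the recursion, hence are proportional to
the Frobenius coefficients: `Qₖ = Q₀ cₖ`. [cite: Hartman2002, Ch. IV §12 (12.12)] -/
theorem coeff_eq_coeff_zero_mul_of_legOp_eq_zero (m : ℕ) (ν : ℂ) {Q : ℂ[X]} (hQ : legOp m ν Q = 0) (k : ℕ) :
    Q.coeff k = Q.coeff 0 * sphmCoeff m ν 0 k := by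
  induction k with
  | zero => simp
  | succ k ih =>
    have h1 : 2 * ((k : ℂ) + 1) * ((k : ℂ) + m + 1) * Q.coeff (k + 1) =
        ((k : ℂ) * ((k : ℂ) + 2 * m + 1) - ν) * Q.coeff k := by
      have h := congrArg (fun P : ℂ[X] ↦ P.coeff k) hQ
      simp only [coeff_legOp, coeff_zero] at h
      exact sub_eq_zero.1 h
    have h2 := sphmCoeff_step_kappa_zero m ν k
    have hne := two_mul_succ_mul_ne_zero m k
    apply mul_left_cancel₀ hne
    rw [h1, ih]
    linear_combination (-(Q.coeff 0)) * h2

/-- The leading coefficient of the reflected polynomial: `(legPoly ∘ (2 − X))ₙ = (−1)ⁿ cₙ`.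
[folklore] -/
theorem coeff_legPoly_comp_reflect (m n : ℕ) :
    ((legPoly m n).comp (2 - X)).coeff n = (-1) ^ n * sphmCoeff m (legNu m n) 0 n := by
  have hsum : (∑ k ∈ Finset.range (n + 1), C (sphmCoeff m (legNu m n) 0 k) * X ^ k).comp (2 - X) =
      ∑ k ∈ Finset.range (n + 1), (C (sphmCoeff m (legNu m n) 0 k) * X ^ k).comp (2 - X) :=
    map_sum (compRingHom ((2 : ℂ[X]) - X)) (fun k ↦ C (sphmCoeff m (legNu m n) 0 k) * X ^ k) (Finset.range (n + 1))
  rw [legPoly, hsum, finsetSum_coeff, Finset.sum_range_succ]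
  simp only [mul_comp, C_comp, pow_comp, X_comp, coeff_C_mul]
  -- lower-degree terms do not contribute
  have hlow : ∑ k ∈ Finset.range n, sphmCoeff m (legNu m n) 0 k * (((2 : ℂ[X]) - X) ^ k).coeff n = 0 := by
    refine Finset.sum_eq_zero fun k hk ↦ ?_
    rw [Finset.mem_range] at hk
    rw [coeff_eq_zero_of_natDegree_lt, mul_zero]
    calc (((2 : ℂ[X]) - X) ^ k).natDegree ≤ k * ((2 : ℂ[X]) - X).natDegree := natDegree_pow_le
      _ ≤ k * 1 := by
          gcongr
          refine (natDegree_sub_le _ _).trans ?_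
          rw [natDegree_X, show (2 : ℂ[X]) = C 2 from (map_ofNat C 2).symm, natDegree_C]
          simp
      _ < n := by omega
  rw [hlow, zero_add]
  -- the top term: `(C 2 − X)^n = (−1)^n (X − C 2)^n`, monic part has top coefficient `1`
  have htop : (((2 : ℂ[X]) - X) ^ n).coeff n = (-1) ^ n := by
    have h1 : ((2 : ℂ[X]) - X) ^ n = C ((-1) ^ n) * (X - C 2) ^ n := by
      have h0 : (2 : ℂ[X]) - X = C (-1) * (X - C 2) := by
        rw [show (2 : ℂ[X]) = C 2 from (map_ofNat C 2).symm, show (C (-1) : ℂ[X]) = -1 by simp]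
        ring
      rw [h0, mul_pow, ← C_pow]
    rw [h1, coeff_C_mul]
    have hmon : ((X - C (2 : ℂ)) ^ n).Monic := (monic_X_sub_C 2).pow n
    have hdeg : ((X - C (2 : ℂ)) ^ n).natDegree = n := by
      rw [natDegree_pow, natDegree_X_sub_C, mul_one]
    have h2 := hmon.coeff_natDegree
    rw [hdeg] at h2
    rw [h2, mul_one]
  rw [htop, mul_comm]

/-- **Parity of the Gegenbauer polynomial about the equator**: `legPoly(2 − X) = (−1)ⁿ legPoly(X)`
(in `x = 1 − t`: the regular solution is even for even `n`, odd for odd `n`). The reflected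
polynomial solves the same equation, so by the recursion it is `legPoly(2 − ·)(0) · legPoly`, and
comparing top coefficients gives the constant `(−1)ⁿ`. [cite: Hartman2002, Ch. IV §12 Exercise 12.3] -/
theorem legPoly_comp_reflect (m n : ℕ) : (legPoly m n).comp (2 - X) = C ((-1) ^ n) * legPoly m n := by
  set D := (legPoly m n).comp (2 - X) with hD
  have hLD : legOp m (legNu m n) D = 0 := by
    rw [hD, legOp_comp_reflect, legOp_legPoly, zero_comp]
  have hcoeff : ∀ k, D.coeff k = D.coeff 0 * sphmCoeff m (legNu m n) 0 k :=
    coeff_eq_coeff_zero_mul_of_legOp_eq_zero m (legNu m n) hLD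
  -- the constant `D₀ = (−1)ⁿ` from the top coefficient
  have hD0 : D.coeff 0 = (-1) ^ n := by
    have h1 := hcoeff n
    rw [hD, coeff_legPoly_comp_reflect] at h1
    exact (mul_right_cancel₀ (sphmCoeff_ne_zero_of_le m n le_rfl) h1).symm
  ext k
  rw [hcoeff k, hD0, coeff_C_mul, coeff_legPoly]

/-! ### The shooting function vanishes at the Legendre eigenvalues of even excess -/

/-- **Zeros of the shooting function at zero spheroidicity.** For even `n`,
`q'(1; m, νₙ, 0) = 0`: differentiating `legPoly(2 − t) = legPoly(t)` at the equator `t = 1`.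
Hence `(ν, κ) = (νₙ, 0)`, `νₙ + m(m+1) = l(l+1)`, `l = n + m`, is a zero of the shooting function
and `E = q(1 − |x|)` is the (associated Legendre) eigenfunction, smooth across both poles
(`SpheroidalHarmonicEigenfunction.lean`). SR, CMP 329 (2014), App. B (`λ_{ml}(0) = l(l+1)`).
[cite: ShlapentokhRothman2014KleinGordon, App. B] -/
theorem sphmDer_one_eq_zero_of_even (m : ℕ) {n : ℕ} (hn : Even n) : sphmDer m (legNu m n) 0 1 = 0 := by
  have h1 : ‖(1 : ℂ)‖ < 5 / 4 := by norm_num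
  rw [sphmDer_legNu_eq_eval h1]
  have hrefl := legPoly_comp_reflect m n
  rw [hn.neg_one_pow, C_1, one_mul] at hrefl
  -- differentiate the identity and evaluate at `t = 1`
  have hd := congrArg (fun P : ℂ[X] ↦ (derivative P).eval 1) hrefl
  simp only [derivative_comp, derivative_sub, derivative_X, eval_mul, eval_one, eval_comp, eval_sub,
    eval_X] at hd
  norm_num at hd
  linear_combination (-1 / 2 : ℂ) * hd

/-- For odd `n`, `q(1; m, νₙ, 0) = 0` (the odd eigenfunctions). [cite: ShlapentokhRothman2014KleinGordon, App. B] -/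
theorem sphmFun_one_eq_zero_of_odd (m : ℕ) {n : ℕ} (hn : Odd n) : sphmFun m (legNu m n) 0 1 = 0 := by
  rw [sphmFun_legNu_eq_eval]
  have hrefl := legPoly_comp_reflect m n
  rw [hn.neg_one_pow] at hrefl
  have hd := congrArg (fun P : ℂ[X] ↦ P.eval 1) hrefl
  simp only [eval_comp, eval_sub, eval_C, eval_X, eval_mul] at hd
  norm_num at hd
  linear_combination hd / 2

end Literature.Analysis.SpecialFunctions

end
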